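import Literature.NumberTheory.Automorphic.TateLocalZetaShells
import HarnessLib

/-!
# Tate's local theory: Schwartz–Bruhat functions on `F`, their zeta integrals and Fourier
transforms (proved)

Second groundwork file for the existence half of Tate's local functional equation
(`TateLocalFunctionalEquation`; Tate 1950, §2.2–2.5), over a non-archimedean local field `F`
(`𝔭^n = primePowBall F n`, `ψ` an additive character of conductor exponent `m`, `μ` an additive
Haar measure, `μ'` a Haar measure on `Fˣ`).  Everything is PROVED (theorems only):

* structure of `𝒮(F)` (`SchwartzBruhat F`: locally constant, compactly supported): every
  `f ∈ 𝒮(F)` is invariant under some `𝔭^n` (`exists_forall_add_eq_of_mem_schwartzBruhat`),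
  supported in some `𝔭^{n₀}` and bounded (Tate 1950, §2.2; Bushnell–Henniart 2006, §23.1);
* **absolute convergence of zeta integrals** (Tate 1950, §2.4, axiom `𝔷₂` and Lemma 2.4.1):
  `x ↦ f(x) χ(x) |x|^s` is integrable on `Fˣ` for `f ∈ 𝒮(F)`, `χ` of exponent `σ` and
  `re s > -σ` (`integrable_tateZetaIntegrand`);
* **the Fourier transform preserves `𝒮(F)`** (Tate 1950, §2.2, the `p`-adic case of the class
  `𝔅₁`; Bushnell–Henniart 2006, §23.1 Proposition): `f̂` vanishes off `𝔭^{m-n}` and is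
  `𝔭^{m-n₀}`-invariant (`fourierSB_mem_schwartzBruhat`);
* the explicit transforms of Tate 1950, §2.5: `(1_{𝔭^k})^ = μ(𝔭^k) 1_{𝔭^{m-k}}`,
  `(1_{1+𝔭^c})^ = μ(𝔭^c) ψ · 1_{𝔭^{m-c}}` (`c ≥ 1`) and
  `(ψ · 1_{𝔭^n})^(z) = μ(𝔭^n) 1_{𝔭^{m-n}}(1 + z)`.

## References

* J. Tate, *Fourier analysis in number fields and Hecke's zeta-functions* (1950), in
  Cassels–Fröhlich, *Algebraic Number Theory* (1967), Ch. XV, §2.2, §2.4 (Lemma 2.4.1), §2.5.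
  [Tate1950] [CasselsFrohlichANT1967]
* C. J. Bushnell, G. Henniart, *The local Langlands conjecture for GL(2)* (2006), §23.1.
  [BushnellHenniart2006]
-/

set_option autoImplicit false

noncomputable section

open scoped NNReal ENNReal Topology Pointwise
open MeasureTheory ValuativeRel Filter Set Function
  Literature.NumberTheory.GaloisRepresentations.IsNonarchimedeanLocalField

namespace Literature.NumberTheory.Automorphic

variable {F : Type*} [Field F] [ValuativeRel F] [TopologicalSpace F] [IsNonarchimedeanLocalField F]

/-! ### Structure of Schwartz–Bruhat functions on `F` -/

section Structure

/-- **Uniform local constancy**: a Schwartz–Bruhat function on `F` is invariant under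
translation by some ball `𝔭^n` (Tate 1950, §2.2: locally constant functions of compact support;
Bushnell–Henniart 2006, §23.1). [cite: BushnellHenniart2006, §23.1] -/
theorem exists_forall_add_eq_of_mem_schwartzBruhat {f : F → ℂ} (hf : f ∈ SchwartzBruhat F) :
    ∃ n : ℤ, ∀ x, ∀ h ∈ primePowBall F n, f (x + h) = f x := by
  obtain ⟨hlc, hcs⟩ := (mem_schwartzBruhat_iff).1 hf
  have hloc : ∀ x : F, ∃ n : ℕ, ∀ h ∈ primePowBall F (n : ℤ), f (x + h) = f x := by
    intro x
    have h1 : {y | f y = f x} ∈ 𝓝 x := (hlc.isOpen_fiber (f x)).mem_nhds rfl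
    have h2 : (fun h => x + h) ⁻¹' {y | f y = f x} ∈ 𝓝 (0 : F) :=
      (continuous_const.add continuous_id).continuousAt.preimage_mem_nhds (by simpa using h1)
    obtain ⟨n, hn⟩ := exists_primePowBall_subset_of_mem_nhds_zero h2
    exact ⟨n, fun h hh => hn hh⟩
  choose n hn using hloc
  set K := tsupport f with hK
  have hU : ∀ x ∈ K, x +ᵥ primePowBall F (n x : ℤ) ∈ 𝓝 x := fun x _ => by
    have h := (vadd_mem_nhds_vadd_iff (t := primePowBall F (n x : ℤ)) x (a := (0 : F))).2
      (primePowBall_mem_nhds_zero _)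
    rwa [vadd_eq_add, add_zero] at h
  obtain ⟨t, -, ht⟩ := hcs.elim_nhds_subcover (fun x => x +ᵥ primePowBall F (n x : ℤ)) hU
  set N : ℕ := t.sup n with hN
  have hNx : ∀ x ∈ t, primePowBall F (N : ℤ) ⊆ primePowBall F (n x : ℤ) := fun x hx =>
    primePowBall_antitone (by exact_mod_cast Finset.le_sup hx)
  have step1 : ∀ x ∈ K, ∀ h ∈ primePowBall F (N : ℤ), f (x + h) = f x := by
    intro x hx h hh
    obtain ⟨i, hi, hxi⟩ := Set.mem_iUnion₂.1 (ht hx)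
    obtain ⟨k, hk, rfl⟩ := Set.mem_vadd_set.1 hxi
    rw [vadd_eq_add, add_assoc, hn i _ (add_mem_primePowBall hk (hNx i hi hh)), hn i _ hk]
  refine ⟨N, fun x h hh => ?_⟩
  by_cases hx : x ∈ K
  · exact step1 x hx h hh
  · have hfx : f x = 0 := image_eq_zero_of_notMem_tsupport hx
    by_cases hxh : x + h ∈ K
    · have h' := step1 (x + h) hxh (-h) (neg_mem_primePowBall hh)
      rw [add_neg_cancel_right] at h'
      rw [← h']
    · rw [image_eq_zero_of_notMem_tsupport hxh, hfx]

/-- A Schwartz–Bruhat function on `F` is supported in some ball `𝔭^{n₀}`. [folklore] -/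
theorem exists_eq_zero_of_notMem_primePowBall {f : F → ℂ} (hf : f ∈ SchwartzBruhat F) :
    ∃ n₀ : ℤ, ∀ x ∉ primePowBall F n₀, f x = 0 := by
  obtain ⟨-, hcs⟩ := (mem_schwartzBruhat_iff).1 hf
  have hcover : tsupport f ⊆ ⋃ k : ℕ, primePowBall F (-(k : ℤ)) := by
    intro x _
    obtain ⟨m, hm⟩ := exists_mem_primePowBall x
    exact Set.mem_iUnion.2 ⟨(-m).toNat, primePowBall_antitone (by omega) hm⟩
  have hdir : Directed (· ⊆ ·) fun k : ℕ => primePowBall F (-(k : ℤ)) :=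
    Monotone.directed_le fun a b hab => primePowBall_antitone (by omega)
  obtain ⟨k, hk⟩ := hcs.elim_directed_cover _ (fun k => isOpen_primePowBall _) hcover hdir
  exact ⟨-(k : ℤ), fun x hx => image_eq_zero_of_notMem_tsupport fun h => hx (hk h)⟩

omit [Field F] [ValuativeRel F] [IsNonarchimedeanLocalField F] in
/-- A Schwartz–Bruhat function is bounded. [folklore] -/
theorem exists_norm_le_of_mem_schwartzBruhat {f : F → ℂ} (hf : f ∈ SchwartzBruhat F) :
    ∃ C : ℝ, 0 ≤ C ∧ ∀ x, ‖f x‖ ≤ C := by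
  obtain ⟨hlc, hcs⟩ := (mem_schwartzBruhat_iff).1 hf
  obtain ⟨C, hC⟩ := hcs.exists_bound_of_continuous hlc.continuous
  exact ⟨max C 0, le_max_right _ _, fun x => (hC x).trans (le_max_left _ _)⟩

omit [Field F] [ValuativeRel F] [IsNonarchimedeanLocalField F] in
/-- A Schwartz–Bruhat function is continuous. [folklore] -/
theorem continuous_of_mem_schwartzBruhat {f : F → ℂ} (hf : f ∈ SchwartzBruhat F) :
    Continuous f :=
  ((mem_schwartzBruhat_iff).1 hf).1.continuous

/-- The indicator function of a ball is Schwartz–Bruhat. [folklore] -/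
theorem indicator_primePowBall_mem_schwartzBruhat (n : ℤ) (c : ℂ) :
    (primePowBall F n).indicator (fun _ => c) ∈ SchwartzBruhat F := by
  rw [mem_schwartzBruhat_iff]
  refine ⟨?_, HasCompactSupport.intro' (isCompact_primePowBall n) (isClosed_primePowBall n)
    fun x hx => Set.indicator_of_notMem hx _⟩
  rw [IsLocallyConstant.iff_exists_open]
  intro x
  by_cases hx : x ∈ primePowBall F n
  · exact ⟨_, isOpen_primePowBall n, hx, fun y hy => by
      rw [Set.indicator_of_mem hy, Set.indicator_of_mem hx]⟩
  · exact ⟨_, (isClosed_primePowBall n).isOpen_compl, hx, fun y hy => by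
      rw [Set.indicator_of_notMem hy, Set.indicator_of_notMem hx]⟩

/-- The indicator function of the coset `1 + 𝔭^c` is Schwartz–Bruhat. [folklore] -/
theorem indicator_one_vadd_primePowBall_mem_schwartzBruhat (n : ℤ) (c : ℂ) :
    ((1 : F) +ᵥ primePowBall F n).indicator (fun _ => c) ∈ SchwartzBruhat F := by
  have ho : IsOpen ((1 : F) +ᵥ primePowBall F n) := (isOpen_primePowBall n).vadd _
  have hc : IsClosed ((1 : F) +ᵥ primePowBall F n) := (isClosed_primePowBall n).vadd _
  rw [mem_schwartzBruhat_iff]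
  refine ⟨?_, HasCompactSupport.intro' ((isCompact_primePowBall n).vadd _) hc
    fun x hx => Set.indicator_of_notMem hx _⟩
  rw [IsLocallyConstant.iff_exists_open]
  intro x
  by_cases hx : x ∈ (1 : F) +ᵥ primePowBall F n
  · exact ⟨_, ho, hx, fun y hy => by rw [Set.indicator_of_mem hy, Set.indicator_of_mem hx]⟩
  · exact ⟨_, hc.isOpen_compl, hx, fun y hy => by
      rw [Set.indicator_of_notMem hy, Set.indicator_of_notMem hx]⟩

end Structure


/-! ### Absolute convergence of zeta integrals -/

section ZetaIntegrability

/-- The norm of Tate's zeta integrand: `‖f(x) χ(x) |x|^s‖ = ‖f(x)‖ |x|^{σ + re s}` for `χ` of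
exponent `σ` (Tate 1950, §2.3: `|c(α)| = |α|^σ`). [cite: Tate1950, §2.3] -/
theorem norm_tateZetaIntegrand {χ : QuasiChar F} {σ : ℝ} (hσ : χ.HasExponent σ) (f : F → ℂ)
    (s : ℂ) (x : Fˣ) :
    ‖f (x : F) * ((χ x : ℂˣ) : ℂ) * (((normAbs F (x : F) : ℝ≥0) : ℝ) : ℂ) ^ s‖ =
      ‖f (x : F)‖ * ((normAbs F (x : F) : ℝ≥0) : ℝ) ^ (σ + s.re) := by
  have hpos : (0 : ℝ) < ((normAbs F (x : F) : ℝ≥0) : ℝ) := by exact_mod_cast normAbs_units_pos x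
  rw [norm_mul, norm_mul, hσ x, Complex.norm_cpow_eq_rpow_re_of_pos hpos, mul_assoc,
    ← Real.rpow_add hpos]

omit [ValuativeRel F] [IsNonarchimedeanLocalField F] in
/-- `x ↦ χ(x) ∈ ℂ` is continuous on `Fˣ`. [folklore] -/
theorem continuous_quasiChar_coe (χ : QuasiChar F) : Continuous fun x : Fˣ => ((χ x : ℂˣ) : ℂ) :=
  Units.continuous_val.comp (map_continuous χ)

/-- `x ↦ |x|^s ∈ ℂ` is locally constant on `Fˣ`. [folklore] -/
theorem isLocallyConstant_normAbs_cpow (s : ℂ) :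
    IsLocallyConstant fun x : Fˣ => (((normAbs F (x : F) : ℝ≥0) : ℝ) : ℂ) ^ s :=
  (isLocallyConstant_normAbs_units (F := F)).comp fun r : ℝ≥0 => ((r : ℝ) : ℂ) ^ s

variable [MeasurableSpace F] [BorelSpace F]

/-- Tate's zeta integrand is strongly measurable for continuous `f`. [folklore] -/
theorem aestronglyMeasurable_tateZetaIntegrand (μ' : Measure Fˣ) {f : F → ℂ} (hf : Continuous f)
    (χ : QuasiChar F) (s : ℂ) :
    AEStronglyMeasurable (fun x : Fˣ =>
      f (x : F) * ((χ x : ℂˣ) : ℂ) * (((normAbs F (x : F) : ℝ≥0) : ℝ) : ℂ) ^ s) μ' := by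
  haveI : BorelSpace Fˣ := Units.borelSpace
  exact (((hf.comp Units.continuous_val).mul (continuous_quasiChar_coe χ)).mul
    (isLocallyConstant_normAbs_cpow s).continuous).aestronglyMeasurable

/-- **Absolute convergence of Tate's zeta integral** (Tate 1950, §2.4, condition `𝔷₂` and
Lemma 2.4.1; Bushnell–Henniart 2006, §23.2): for `f ∈ 𝒮(F)`, `χ` of exponent `σ` and
`re s > -σ`, the integrand `f(x) χ(x) |x|^s` of `Z(f, χ, s)` is integrable on `Fˣ` for every
left-invariant measure finite on compacts (`|f χ |·|^s| ≤ C 1_{𝔭^{n₀}} |·|^{σ + re s}`).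
[cite: Tate1950, §2.4, Lemma 2.4.1] -/
theorem integrable_tateZetaIntegrand (μ' : Measure Fˣ) [IsFiniteMeasureOnCompacts μ']
    [μ'.IsMulLeftInvariant] {f : F → ℂ} (hf : f ∈ SchwartzBruhat F) {χ : QuasiChar F} {σ : ℝ}
    (hσ : χ.HasExponent σ) {s : ℂ} (hs : -σ < s.re) :
    Integrable (fun x : Fˣ =>
      f (x : F) * ((χ x : ℂˣ) : ℂ) * (((normAbs F (x : F) : ℝ≥0) : ℝ) : ℂ) ^ s) μ' := by
  obtain ⟨n₀, hn₀⟩ := exists_eq_zero_of_notMem_primePowBall hf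
  obtain ⟨C, -, hC⟩ := exists_norm_le_of_mem_schwartzBruhat hf
  refine integrable_units_of_norm_le μ'
    (aestronglyMeasurable_tateZetaIntegrand μ' (continuous_of_mem_schwartzBruhat hf) χ s)
    n₀ (t := σ + s.re) (by linarith) C fun x => ?_
  rw [norm_tateZetaIntegrand hσ]
  by_cases hx : (x : F) ∈ primePowBall F n₀
  · rw [Set.indicator_of_mem (show x ∈ {x : Fˣ | (x : F) ∈ primePowBall F n₀} from hx)]
    exact mul_le_mul_of_nonneg_right (hC _) (Real.rpow_nonneg (NNReal.coe_nonneg _) _)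
  · rw [hn₀ _ hx, norm_zero, zero_mul,
      Set.indicator_of_notMem (show x ∉ {x : Fˣ | (x : F) ∈ primePowBall F n₀} from hx), mul_zero]

end ZetaIntegrability

/-! ### The Fourier transform preserves `𝒮(F)` -/

section Fourier

variable [MeasurableSpace F] [BorelSpace F]

/-- If `f` is invariant under translation by `h`, then `f̂(y) = ψ(hy) f̂(y)` (translation
invariance of `μ`). [folklore] -/
theorem fourierSB_eq_addChar_mul_of_forall_add_eq (μ : Measure F) [μ.IsAddLeftInvariant]
    (ψ : AddChar F Circle) {f : F → ℂ} {h : F} (hf : ∀ x, f (x + h) = f x) (y : F) :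
    fourierSB ψ μ f y = ((ψ (h * y) : Circle) : ℂ) * fourierSB ψ μ f y := by
  rw [fourierSB_apply, ← integral_const_mul, ← integral_add_left_eq_self _ h]
  refine integral_congr_ae (Filter.Eventually.of_forall fun x => ?_)
  simp only
  rw [add_comm h x, hf x, add_mul, AddChar.map_add_eq_mul, Circle.coe_mul]
  ring

/-- **`f̂` vanishes off `𝔭^{m-n}`** if `f` is `𝔭^n`-invariant and `ψ` has conductor exponent `m`
(Tate 1950, §2.5; Bushnell–Henniart 2006, §23.1). [cite: Tate1950, §2.5] -/
theorem fourierSB_eq_zero_of_notMem (μ : Measure F) [μ.IsAddLeftInvariant] {ψ : AddChar F Circle}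
    {m : ℤ} (hm : ψ.HasConductorExp m) {f : F → ℂ} {n : ℤ}
    (hf : ∀ x, ∀ h ∈ primePowBall F n, f (x + h) = f x) {y : F}
    (hy : y ∉ primePowBall F (m - n)) : fourierSB ψ μ f y = 0 := by
  obtain ⟨h, hh, hne⟩ := exists_mem_primePowBall_addChar_mul_ne_one hm hy
  have key := fourierSB_eq_addChar_mul_of_forall_add_eq μ ψ (fun x => hf x h hh) y
  have hne' : ((ψ (h * y) : Circle) : ℂ) ≠ 1 := fun e => hne (Circle.coe_eq_one.1 e)
  have h5 : (1 - ((ψ (h * y) : Circle) : ℂ)) * fourierSB ψ μ f y = 0 := by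
    rw [sub_mul, one_mul, ← key, sub_self]
  exact (mul_eq_zero.1 h5).resolve_left (sub_ne_zero.2 (Ne.symm hne'))

omit [BorelSpace F] in
/-- **`f̂` is `𝔭^{m-n₀}`-invariant** if `f` is supported in `𝔭^{n₀}` and `ψ` has conductor
exponent `m` (Tate 1950, §2.5). [cite: Tate1950, §2.5] -/
theorem fourierSB_add_eq_of_support (μ : Measure F) {ψ : AddChar F Circle} {m : ℤ}
    (hm : ψ.HasConductorExp m) {f : F → ℂ} {n₀ : ℤ} (hf : ∀ x ∉ primePowBall F n₀, f x = 0)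
    (y : F) {k : F} (hk : k ∈ primePowBall F (m - n₀)) :
    fourierSB ψ μ f (y + k) = fourierSB ψ μ f y := by
  rw [fourierSB_apply, fourierSB_apply]
  refine integral_congr_ae (Filter.Eventually.of_forall fun x => ?_)
  simp only
  by_cases hx : x ∈ primePowBall F n₀
  · have hxk : x * k ∈ primePowBall F m := by
      have := mul_mem_primePowBall hx hk
      rwa [add_sub_cancel] at this
    rw [mul_add, AddChar.map_add_eq_mul, hm.1 _ hxk, mul_one]
  · rw [hf x hx, mul_zero, mul_zero]

/-- **The Fourier transform of a Schwartz–Bruhat function is Schwartz–Bruhat** (Tate 1950,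
§2.2, `p`-adic case; Bushnell–Henniart 2006, §23.1 Proposition), for `ψ` continuous non-trivial
and any left-invariant `μ`: `f̂` is supported in the compact ball `𝔭^{m-n}` and constant on
cosets of `𝔭^{m-n₀}`. [cite: BushnellHenniart2006, §23.1, Proposition] -/
theorem fourierSB_mem_schwartzBruhat (μ : Measure F) [μ.IsAddLeftInvariant] {ψ : AddChar F Circle}
    (hψ : ψ.IsContinuousNontrivial) {f : F → ℂ} (hf : f ∈ SchwartzBruhat F) :
    fourierSB ψ μ f ∈ SchwartzBruhat F := by
  obtain ⟨m, hm⟩ := hψ.exists_hasConductorExp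
  obtain ⟨n, hn⟩ := exists_forall_add_eq_of_mem_schwartzBruhat hf
  obtain ⟨n₀, hn₀⟩ := exists_eq_zero_of_notMem_primePowBall hf
  rw [mem_schwartzBruhat_iff]
  refine ⟨?_, HasCompactSupport.intro' (isCompact_primePowBall (m - n)) (isClosed_primePowBall _)
    fun y hy => fourierSB_eq_zero_of_notMem μ hm hn hy⟩
  rw [IsLocallyConstant.iff_exists_open]
  intro y
  refine ⟨y +ᵥ primePowBall F (m - n₀), (isOpen_primePowBall _).vadd _,
    Set.mem_vadd_set.2 ⟨0, zero_mem_primePowBall _, by simp⟩, ?_⟩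
  rintro y' ⟨k, hk, rfl⟩
  exact fourierSB_add_eq_of_support μ hm hn₀ y hk

/-! ### The explicit transforms of Tate 1950, §2.5 -/

open scoped Classical in
/-- **`(1_{𝔭^k})^ = μ(𝔭^k) · 1_{𝔭^{m-k}}`** (Tate 1950, §2.5: "`f̂₀` is `N𝔡^{1/2}` times the
characteristic function of `𝔬`"). [cite: Tate1950, §2.5] -/
theorem fourierSB_indicator_primePowBall (μ : Measure F) [μ.IsAddHaarMeasure]
    {ψ : AddChar F Circle} {m : ℤ} (hm : ψ.HasConductorExp m) (k : ℤ) (y : F) :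
    fourierSB ψ μ ((primePowBall F k).indicator fun _ => (1 : ℂ)) y =
      if y ∈ primePowBall F (m - k) then (μ.real (primePowBall F k) : ℂ) else 0 := by
  rw [fourierSB_apply, ← setIntegral_primePowBall_addChar_mul μ hm k y,
    ← integral_indicator (measurableSet_primePowBall k)]
  refine integral_congr_ae (Filter.Eventually.of_forall fun x => ?_)
  simp only
  by_cases hx : x ∈ primePowBall F k
  · rw [Set.indicator_of_mem hx, Set.indicator_of_mem hx, mul_one]
  · rw [Set.indicator_of_notMem hx, Set.indicator_of_notMem hx, mul_zero]

open scoped Classical in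
/-- **`(1_{1+𝔭^c})^ = μ(𝔭^c) · ψ · 1_{𝔭^{m-c}}`** (Tate 1950, §2.5, read backwards: "`f̂_n` is
`N𝔡^{1/2} N𝔭^n` times the characteristic function of `1 + 𝔭^n`" for
`f_n = ψ · 1_{𝔡⁻¹𝔭^{-n}}`). [cite: Tate1950, §2.5] -/
theorem fourierSB_indicator_one_vadd_primePowBall (μ : Measure F) [μ.IsAddHaarMeasure]
    {ψ : AddChar F Circle} {m : ℤ} (hm : ψ.HasConductorExp m) (c : ℤ) (y : F) :
    fourierSB ψ μ (((1 : F) +ᵥ primePowBall F c).indicator fun _ => (1 : ℂ)) y =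
      ((ψ y : Circle) : ℂ) *
        (if y ∈ primePowBall F (m - c) then (μ.real (primePowBall F c) : ℂ) else 0) := by
  rw [fourierSB_apply, ← setIntegral_primePowBall_addChar_mul μ hm c y,
    ← integral_indicator (measurableSet_primePowBall c), ← integral_const_mul,
    ← integral_add_left_eq_self _ (1 : F)]
  refine integral_congr_ae (Filter.Eventually.of_forall fun x => ?_)
  simp only
  by_cases hx : x ∈ primePowBall F c
  · have hx' : (1 : F) + x ∈ (1 : F) +ᵥ primePowBall F c := Set.mem_vadd_set.2 ⟨x, hx, rfl⟩
    rw [Set.indicator_of_mem hx', Set.indicator_of_mem hx, add_mul, one_mul,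
      AddChar.map_add_eq_mul, Circle.coe_mul, mul_one]
  · have hx' : (1 : F) + x ∉ (1 : F) +ᵥ primePowBall F c := fun h' => by
      obtain ⟨x', hx'', h⟩ := Set.mem_vadd_set.1 h'
      rw [vadd_eq_add, add_right_inj] at h
      exact hx (h ▸ hx'')
    rw [Set.indicator_of_notMem hx', Set.indicator_of_notMem hx, mul_zero, mul_zero]

open scoped Classical in
/-- **`(ψ · 1_{𝔭^n})^(z) = μ(𝔭^n) · 1_{𝔭^{m-n}}(1 + z)`** (Tate 1950, §2.5, the computation of
`f̂_n`: "`∫_{𝔡⁻¹𝔭^{-n}} e^{-2πiΛ((ξ-1)η)} dη`"). [cite: Tate1950, §2.5] -/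
theorem fourierSB_addChar_mul_indicator_primePowBall (μ : Measure F) [μ.IsAddHaarMeasure]
    {ψ : AddChar F Circle} {m : ℤ} (hm : ψ.HasConductorExp m) (n : ℤ) (z : F) :
    fourierSB ψ μ (fun x => ((ψ x : Circle) : ℂ) *
        (primePowBall F n).indicator (fun _ => (1 : ℂ)) x) z =
      if 1 + z ∈ primePowBall F (m - n) then (μ.real (primePowBall F n) : ℂ) else 0 := by
  rw [fourierSB_apply, ← setIntegral_primePowBall_addChar_mul μ hm n (1 + z),
    ← integral_indicator (measurableSet_primePowBall n)]
  refine integral_congr_ae (Filter.Eventually.of_forall fun x => ?_)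
  simp only
  by_cases hx : x ∈ primePowBall F n
  · rw [Set.indicator_of_mem hx, Set.indicator_of_mem hx, mul_one, mul_add, mul_one,
      AddChar.map_add_eq_mul, Circle.coe_mul, mul_comm]
  · rw [Set.indicator_of_notMem hx, Set.indicator_of_notMem hx, mul_zero, mul_zero]

end Fourier

end Literature.NumberTheory.Automorphic
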